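import Summits.CriticalPhenomena.Ising3DConformalLimit.Theses.ThresholdDilation
import Summits.CriticalPhenomena.Ising3DConformalLimit.Theses.HyperoctahedralRP
import Summits.CriticalPhenomena.Ising3DConformalLimit.Theses.WeylWindow
import Summits.CriticalPhenomena.Ising3DConformalLimit.Theorems.MoebiusLimitExists.Negative.ScaleRedundant
import Summits.CriticalPhenomena.Ising3DConformalLimit.Theorems.MoebiusLimitExists.Negative.FreeTranslations
import Summits.CriticalPhenomena.Ising3DConformalLimit.Theorems.HyperoctahedralRPLimitRotationInvariant
import Summits.CriticalPhenomena.Ising3DConformalLimit.Theorems.HyperoctahedralRPHRP2Rigidity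
import Summits.CriticalPhenomena.Ising3DConformalLimit.Theorems.MoebiusLimitOfTwoPointLaw.Negative.CanonicalForm
import HarnessLib

/-!
# Crux `ThresholdDilation.ConformalLimitOfDyadicLaw` (item stmt-CriticalPhenomena-6324): the typed split
# `LimitExistsOfDyadicLaw → InversionUpgradeNormalised → IsingEuclidUpgradeR4NonGaussian → crux`
# (crux-strategist, BC2 redirect of the restated deciding crux of route `ThresholdDilation`)

The crux is `DyadicScalingLaw → Ising3DConformalLimit`: the summit conjunct GIVEN the route's hinge, the axis
two-point dyadic law `g(2n)·4^Δ/g(n) → 1` (`g(n) = ⟨σ₀σ_{ne₀}⟩⁺_{β_c(3)}`). As typed it keeps all of the conjunct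
(existence of every `n`-point limit, Möbius covariance, `U₄ ≢ 0`), so it is at least the summit (route re-audit,
bin RESTATED). This file is the kernel-checked ASSEMBLY of its decomposition into three pieces, each strictly
weaker than the crux and than the conjunct:

* `X₁ = DyadicScalingLaw → WeylWindow.LimitExists` (child `LimitExistsOfDyadicLaw`): GIVEN the dyadic law, the
  critical correlators on `ℤ³` have SOME non-degenerate pointwise scaling limit `(ρ, S)` — bare existence, no
  symmetry, no normalisation (item stmt-CriticalPhenomena-4738 is its conclusion; the child is "4738 modulo the
  route's own output", see `limitExists_iff_dyadic_and_child`);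
* `X₂ = HyperoctahedralRP.InversionUpgradeNormalised` (item stmt-CriticalPhenomena-1982 verbatim): the inversion
  upgrade of a normalised, non-degenerate, Euclidean-invariant, scale-covariant limit;
* `X₃ = HyperoctahedralRP.IsingEuclidUpgradeR4NonGaussian` (item stmt-CriticalPhenomena-0636 verbatim): every
  non-degenerate pointwise limit has `U₄ ≢ 0`.

`conformalLimitOfDyadicLaw_of_subs : X₁ → X₂ → X₃ → crux`. The seam is NOT a conjunction split of the conjunct:
between bare existence (`X₁`) and the two upgrades the assembly supplies, from LANDED theorems, everything the
conjunct asks of the limit except inversion and `U₄` — normalisation off `NonCoincident`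
(`normalised_hasLimit/_nondeg`), translation invariance (`isTranslationInvariant_normalised_of_limit`, free for
any limit), scale covariance with a dimension `Δ ∈ [1/2, 1]` (`exists_scaleCovariant_normalised`: Messager–
Miracle-Solé in the limit + Cauchy's equation + the `ℤ³` window), and `O(3)` invariance
(`LimitRotationInvariant_of ∘ HRP2Rigidity_of`, items 1980/1979, theorems of the tree) — and then feeds `X₂`
(inversion, with the same `Δ`) and `X₃`.

Honesty record (why `X₁` is guarded by the dyadic law, and what the guard is worth):
`dyadicScalingLaw_of_limitExists` — bare existence (4738) already implies the dyadic law, with the limit's own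
dimension (`tendsto_axis_ratio_of_limit`: along the meshes `1/(n+1)` the axis pair `(0,e₀),(0,2e₀)` reads
`g(2n)/g(n) → S₂(0,2e₀)/S₂(0,e₀) = 4^{-Δ}`); hence `limitExists_iff_dyadic_and_child : 4738 ↔ D ∧ X₁` — the child
is exactly the part of bare existence that the route's engine `(R) ∧ (V) ⇒ D` does not deliver, and
`delta_eq_of_dyadicLaw` pins the dimension of the assembled limit to the route's `Δ`.

References: H. Duminil-Copin, ICM 2022, §8.1 p. 25 (covariance postulates), §8.4 p. 29 (existence and the CFT
question open on `ℤ³`); Di Francesco–Mathieu–Sénéchal 1997 §4.3.1 eq. (4.62) (Möbius = Euclid + dilations +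
inversion). No definitions, no `sorry`.
-/

noncomputable section

namespace Summit.CriticalPhenomena.Ising3DConformalLimit.ThresholdDilationConformalLimitOfDyadicLawSplit

open Literature.Probability.LatticeModels Filter Topology
open Summit.CriticalPhenomena.Ising3DConformalLimit.Theses
open Summit.CriticalPhenomena.Ising3DConformalLimit.MoebiusLimitExistsNegative
open Summit.CriticalPhenomena.Ising3DConformalLimit.Theorems.MoebiusLimitOfTwoPointLaw.Negative
  (rescaledCorrelator_criticalCorr_unitVec latticeApprox_unitVec)

/-! ### The assembly -/

open Classical in
/-- **BC2 redirect of crux 6324.** `(DyadicScalingLaw → LimitExists) → InversionUpgradeNormalised →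
IsingEuclidUpgradeR4NonGaussian → ConformalLimitOfDyadicLaw`: given the dyadic law, `X₁` yields a
non-degenerate pointwise limit `(ρ, S)`; its normalisation `S♮` (zero off `NonCoincident`) is translation
invariant (free), scale covariant with some `Δ ∈ [1/2,1]` (free) and hence `O(3)` invariant (items 1979/1980,
theorems); `X₂` makes it inversion covariant with the same `Δ`, `X₃` gives `U₄ ≢ 0`; this is the conjunct.
[cite: DuminilCopinICM2022, §8.1 p. 25 and §8.4 p. 29] -/
theorem conformalLimitOfDyadicLaw_of_subs
    (h₁ : ThresholdDilation.DyadicScalingLaw → WeylWindow.LimitExists)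
    (h₂ : HyperoctahedralRP.InversionUpgradeNormalised)
    (h₃ : HyperoctahedralRP.IsingEuclidUpgradeR4NonGaussian) :
    ThresholdDilation.ConformalLimitOfDyadicLaw := by
  intro hD
  obtain ⟨ρ, S, hρ, hlim, hnd⟩ := h₁ hD
  -- dilations are free, with the `ℤ³` window `Δ ∈ [1/2, 1]`
  obtain ⟨Δ, hwin, hsc'⟩ := exists_scaleCovariant_normalised hρ hlim hnd
  have hlim' := normalised_hasLimit hlim
  have hnd' := normalised_nondeg hnd
  have hnorm' : ∀ (n : ℕ) (z : Fin n → EuclideanSpace ℝ (Fin 3)), z ∉ NonCoincident 3 n →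
      (fun (n : ℕ) (x : Fin n → EuclideanSpace ℝ (Fin 3)) =>
        if x ∈ NonCoincident 3 n then S n x else 0) n z = 0 := fun n z hz => by
    simp only [if_neg hz]
  -- translations are free
  have htr' := isTranslationInvariant_normalised_of_limit hlim
  -- rotations: items 1980 and 1979 are theorems of the tree
  have hrot' : IsRotationInvariant (fun (n : ℕ) (x : Fin n → EuclideanSpace ℝ (Fin 3)) =>
      if x ∈ NonCoincident 3 n then S n x else 0) :=
    Cruxes.LimitRotationInvariant.QuarterTurnLiouville.LimitRotationInvariant_of
      Cruxes.HRP2Rigidity.XRayMellin.HRP2Rigidity_of ρ Δ _ hρ hlim' hnorm' hnd' htr' hsc'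
  -- the two open upgrades
  have hinv' := h₂ ρ Δ _ hρ hlim' hnorm' hnd' ⟨htr', hrot'⟩ hsc'
  have hU' := h₃ ρ _ hρ hlim' hnd'
  exact ⟨ρ, Δ, _, hρ, by linarith [hwin.1], hlim', hnd', ⟨⟨htr', hrot'⟩, hsc', hinv'⟩, hU'⟩

/-! ### The axis ratio `g(2n)/g(n)` read off ANY non-degenerate limit -/

/-- `[2e₀/δ] = ⌊2/δ⌋ e₀` at every mesh. [folklore] -/
theorem latticeApprox_two_unitVec (δ : ℝ) :
    latticeApprox δ ((2 : ℝ) • EuclideanSpace.single (0 : Fin 3) (1 : ℝ)) =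
      Pi.single (0 : Fin 3) ⌊2 / δ⌋ := by
  funext i
  rw [latticeApprox_apply, PiLp.smul_apply, unitVec_apply, smul_eq_mul]
  by_cases hi : i = 0
  · subst hi; rw [if_pos rfl, Pi.single_eq_same, mul_one]
  · rw [if_neg hi, Pi.single_eq_of_ne hi, mul_zero, zero_div, Int.floor_zero]

/-- The rescaled critical pair correlator at `(0, 2e₀)`, every mesh: `ρ(δ)² ⟨σ₀σ_{⌊2/δ⌋e₀}⟩_{β_c}`.
[folklore] -/
theorem rescaledCorrelator_criticalCorr_two_unitVec (ρ : ℝ → ℝ) (δ : ℝ) :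
    rescaledCorrelator (criticalCorr 3) ρ 2 δ ![0, (2 : ℝ) • EuclideanSpace.single (0 : Fin 3) (1 : ℝ)] =
      ρ δ ^ 2 * criticalTwoPoint 3 (Pi.single (0 : Fin 3) ⌊2 / δ⌋) := by
  rw [rescaledCorrelator_apply, ← criticalCorr_two]
  congr 1
  congr 1
  funext i
  fin_cases i
  · simp [latticeApprox_zero]
  · simpa using latticeApprox_two_unitVec δ

/-- **The axis doubling ratio converges for ANY non-degenerate pointwise limit**:
`g(2n)/g(n) → S₂(0,2e₀)/S₂(0,e₀)` (`g(n) = ⟨σ₀σ_{ne₀}⟩_{β_c}`), read along the meshes `δ = 1/(n+1)`, at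
which `[e₀/δ] = (n+1)e₀` and `[2e₀/δ] = (2n+2)e₀` exactly. [folklore] -/
theorem tendsto_axis_ratio_of_limit {ρ : ℝ → ℝ} {S : CorrFamily 3}
    (hρ : ∀ δ ∈ Set.Ioc (0 : ℝ) 1, 0 < ρ δ) (hlim : HasPointwiseScalingLimit (criticalCorr 3) ρ S)
    (hnd : IsNondegenerateTwoPoint S) :
    Tendsto (fun n : ℕ => criticalTwoPoint 3 (Pi.single 0 ((2 * n : ℕ) : ℤ)) /
        criticalTwoPoint 3 (Pi.single 0 ((n : ℕ) : ℤ))) atTop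
      (𝓝 (S 2 ![0, (2 : ℝ) • EuclideanSpace.single (0 : Fin 3) (1 : ℝ)] /
        S 2 ![0, EuclideanSpace.single (0 : Fin 3) (1 : ℝ)])) := by
  set e : EuclideanSpace ℝ (Fin 3) := EuclideanSpace.single 0 1 with he
  have hz₁ : (![0, e] : Fin 2 → EuclideanSpace ℝ (Fin 3)) ∈ NonCoincident 3 2 := by
    have := axis_mem_nonCoincident (t := 1) one_ne_zero
    simpa [he] using this
  have hz₂ : (![0, (2 : ℝ) • e] : Fin 2 → EuclideanSpace ℝ (Fin 3)) ∈ NonCoincident 3 2 :=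
    axis_mem_nonCoincident two_ne_zero
  have hA : 0 < S 2 ![0, e] := hnd _ hz₁
  -- the two pair correlators along `δ_n = 1/(n+1)`
  have hmesh := tendsto_div_succ_nhdsGT (t := 1) one_pos
  have h1 : Tendsto (fun n : ℕ => rescaledCorrelator (criticalCorr 3) ρ 2 (1 / ((n : ℝ) + 1)) ![0, e])
      atTop (𝓝 (S 2 ![0, e])) := ((hlim 2).tendsto_at hz₁).comp hmesh
  have h2 : Tendsto (fun n : ℕ => rescaledCorrelator (criticalCorr 3) ρ 2 (1 / ((n : ℝ) + 1))
      ![0, (2 : ℝ) • e]) atTop (𝓝 (S 2 ![0, (2 : ℝ) • e])) := ((hlim 2).tendsto_at hz₂).comp hmesh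
  have h3 := h2.div h1 hA.ne'
  -- shift the index by one and identify the terms
  rw [← tendsto_add_atTop_iff_nat 1]
  refine h3.congr fun n => ?_
  have hδpos : (0 : ℝ) < 1 / ((n : ℝ) + 1) := by positivity
  have hδle : 1 / ((n : ℝ) + 1) ≤ 1 := by
    rw [div_le_one (by positivity)]; linarith [(Nat.cast_nonneg n : (0 : ℝ) ≤ n)]
  have hρn : 0 < ρ (1 / ((n : ℝ) + 1)) := hρ _ ⟨hδpos, hδle⟩
  have hfl1 : ⌊1 / (1 / ((n : ℝ) + 1))⌋ = ((n + 1 : ℕ) : ℤ) := by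
    rw [one_div_one_div, show (n : ℝ) + 1 = ((n + 1 : ℕ) : ℤ) by push_cast; ring, Int.floor_intCast]
  have hfl2 : ⌊2 / (1 / ((n : ℝ) + 1))⌋ = ((2 * (n + 1) : ℕ) : ℤ) := by
    rw [div_div_eq_mul_div, div_one, show (2 : ℝ) * ((n : ℝ) + 1) = ((2 * (n + 1) : ℕ) : ℤ) by
      push_cast; ring, Int.floor_intCast]
  have hg : 0 < criticalTwoPoint 3 (Pi.single (0 : Fin 3) ((n + 1 : ℕ) : ℤ)) := by
    have hx : (Pi.single (0 : Fin 3) ((n + 1 : ℕ) : ℤ) : Site 3) ≠ 0 := by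
      intro h0
      have := congr_fun h0 0
      simp at this
      omega
    obtain ⟨c, C, hc, hb⟩ := criticalTwoPoint_bounds_holds (d := 3) le_rfl
    exact lt_of_lt_of_le (mul_pos hc (Real.rpow_pos_of_pos (norm_pos_iff.2 hx) _)) (hb _ hx).1
  simp only [Pi.div_apply]
  rw [he, rescaledCorrelator_criticalCorr_unitVec, ← he, rescaledCorrelator_criticalCorr_two_unitVec,
    hfl1, hfl2, mul_div_mul_left _ _ (pow_pos hρn 2).ne']

/-- For a family that is scale covariant with `Δ` on the axis pair, `S₂(0,2e₀)/S₂(0,e₀) = 4^{-Δ}`.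
[cite: FrancescoMathieuSenechal1997, §4.3.1 eq. (4.62)] -/
theorem axisPair_ratio_of_scaleCovariant {Δ : ℝ} {S : CorrFamily 3} (hsc : IsScaleCovariant Δ S)
    (hA : S 2 ![0, EuclideanSpace.single (0 : Fin 3) (1 : ℝ)] ≠ 0) :
    S 2 ![0, (2 : ℝ) • EuclideanSpace.single (0 : Fin 3) (1 : ℝ)] /
        S 2 ![0, EuclideanSpace.single (0 : Fin 3) (1 : ℝ)] = (4 : ℝ) ^ (-Δ) := by
  have h := hsc 2 2 two_pos ![0, EuclideanSpace.single (0 : Fin 3) (1 : ℝ)]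
  have hcfg : (fun i => (2 : ℝ) • (![0, EuclideanSpace.single (0 : Fin 3) (1 : ℝ)] :
      Fin 2 → EuclideanSpace ℝ (Fin 3)) i) = ![0, (2 : ℝ) • EuclideanSpace.single (0 : Fin 3) (1 : ℝ)] := by
    funext i; fin_cases i <;> simp
  rw [hcfg] at h
  rw [h, mul_div_assoc, div_self hA, mul_one,
    show (4 : ℝ) = (2 : ℝ) ^ ((2 : ℕ) : ℝ) by norm_num, ← Real.rpow_mul (by norm_num : (0 : ℝ) ≤ 2)]
  congr 1
  push_cast
  ring

/-! ### Bare existence already gives the dyadic law; the child is `4738` modulo `D` -/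

open Classical in
/-- **Item 4738 implies the route's hinge.** Any non-degenerate pointwise limit of the critical correlators
on `ℤ³` forces the axis dyadic scaling law `g(2n)·4^Δ/g(n) → 1`, with `Δ ∈ [1/2,1]` the (free) scaling
dimension of the normalised limit. [folklore] -/
theorem dyadicScalingLaw_of_limitExists (h : WeylWindow.LimitExists) : ThresholdDilation.DyadicScalingLaw := by
  obtain ⟨ρ, S, hρ, hlim, hnd⟩ := h
  obtain ⟨Δ, hwin, hsc'⟩ := exists_scaleCovariant_normalised hρ hlim hnd
  have hlim' := normalised_hasLimit hlim
  have hnd' := normalised_nondeg hnd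
  have hz₁ : (![0, EuclideanSpace.single (0 : Fin 3) (1 : ℝ)] : Fin 2 → EuclideanSpace ℝ (Fin 3)) ∈
      NonCoincident 3 2 := zero_unitVec_mem_nonCoincident one_ne_zero
  have hA : (fun (n : ℕ) (x : Fin n → EuclideanSpace ℝ (Fin 3)) =>
      if x ∈ NonCoincident 3 n then S n x else 0) 2 ![0, EuclideanSpace.single (0 : Fin 3) (1 : ℝ)] ≠ 0 :=
    (hnd' _ hz₁).ne'
  have hratio := tendsto_axis_ratio_of_limit hρ hlim' hnd'
  rw [axisPair_ratio_of_scaleCovariant hsc' hA] at hratio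
  refine ⟨Δ, by linarith [hwin.1], ?_⟩
  have hkey := hratio.mul_const ((4 : ℝ) ^ Δ)
  rw [← Real.rpow_add (by norm_num : (0 : ℝ) < 4), neg_add_cancel, Real.rpow_zero] at hkey
  refine hkey.congr fun n => ?_
  try dsimp only
  ring

/-- **`4738 ↔ D ∧ (D → 4738)`**: the child `LimitExistsOfDyadicLaw` is exactly bare existence modulo the
route's own output `DyadicScalingLaw` (delivered by `(R) ∧ (V)`, support `DyadicLawOfImplementer`). [folklore] -/
theorem limitExists_iff_dyadic_and_child :
    WeylWindow.LimitExists ↔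
      ThresholdDilation.DyadicScalingLaw ∧ (ThresholdDilation.DyadicScalingLaw → WeylWindow.LimitExists) :=
  ⟨fun h => ⟨dyadicScalingLaw_of_limitExists h, fun _ => h⟩, fun h => h.2 h.1⟩

/-- **The dyadic law pins the dimension of the assembled limit**: if `g(2n)·4^Δ/g(n) → 1` and a
non-degenerate pointwise limit is scale covariant with `Δ'`, then `Δ' = Δ` (both are read by the axis pair).
[cite: FrancescoMathieuSenechal1997, §4.3.1 eq. (4.55)] -/
theorem delta_eq_of_dyadicLaw {ρ : ℝ → ℝ} {S : CorrFamily 3} {Δ Δ' : ℝ}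
    (hρ : ∀ δ ∈ Set.Ioc (0 : ℝ) 1, 0 < ρ δ) (hlim : HasPointwiseScalingLimit (criticalCorr 3) ρ S)
    (hnd : IsNondegenerateTwoPoint S) (hsc : IsScaleCovariant Δ' S)
    (hD : Tendsto (fun n : ℕ => criticalTwoPoint 3 (Pi.single 0 ((2 * n : ℕ) : ℤ)) * (4 : ℝ) ^ Δ /
        criticalTwoPoint 3 (Pi.single 0 ((n : ℕ) : ℤ))) atTop (𝓝 1)) :
    Δ' = Δ := by
  have hz₁ : (![0, EuclideanSpace.single (0 : Fin 3) (1 : ℝ)] : Fin 2 → EuclideanSpace ℝ (Fin 3)) ∈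
      NonCoincident 3 2 := zero_unitVec_mem_nonCoincident one_ne_zero
  have hA : S 2 ![0, EuclideanSpace.single (0 : Fin 3) (1 : ℝ)] ≠ 0 := (hnd _ hz₁).ne'
  have hratio := tendsto_axis_ratio_of_limit hρ hlim hnd
  rw [axisPair_ratio_of_scaleCovariant hsc hA] at hratio
  -- `g(2n)/g(n) → 4^{-Δ'}` and `g(2n)·4^Δ/g(n) → 1` give `4^{-Δ'}·4^{Δ} = 1`
  have hprod := hratio.mul_const ((4 : ℝ) ^ Δ)
  have hsame : Tendsto (fun n : ℕ => criticalTwoPoint 3 (Pi.single 0 ((2 * n : ℕ) : ℤ)) /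
      criticalTwoPoint 3 (Pi.single 0 ((n : ℕ) : ℤ)) * (4 : ℝ) ^ Δ) atTop (𝓝 1) := by
    refine hD.congr fun n => ?_
    ring
  have heq : (4 : ℝ) ^ (-Δ') * (4 : ℝ) ^ Δ = 1 := tendsto_nhds_unique hprod hsame
  rw [← Real.rpow_add (by norm_num : (0 : ℝ) < 4)] at heq
  have h0 : -Δ' + Δ = 0 := by
    by_contra hne
    have h4 : (1 : ℝ) < 4 := by norm_num
    rcases lt_or_gt_of_ne hne with hlt | hgt
    · have := Real.rpow_lt_rpow_of_exponent_lt h4 hlt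
      rw [heq, Real.rpow_zero] at this
      exact lt_irrefl _ this
    · have := Real.rpow_lt_rpow_of_exponent_lt h4 hgt
      rw [heq, Real.rpow_zero] at this
      exact lt_irrefl _ this
  linarith

end Summit.CriticalPhenomena.Ising3DConformalLimit.ThresholdDilationConformalLimitOfDyadicLawSplit

end
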